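import Literature.MathematicalPhysics.QuantumFieldTheory.BalabanImbrieJaffe1984to88.BIJ88Eq596Density
import Literature.MathematicalPhysics.QuantumFieldTheory.BalabanImbrieJaffe1984to88.BIJ88FinalForm313

/-!
# `BalabanImbrieJaffe1984to88.BIJ88Eq596FibreIntegral` — T. Bałaban, J. Imbrie, A. Jaffe, *Effective action and cluster properties of the
abelian Higgs model*, Commun. Math. Phys. **114** (1988) 257–315 [BalabanImbrieJaffe1988], line 1 of (5.9.6) p. 297 [PDF 41], (5.12.8) p. 303 [PDF 47]
and the RESULT pp. 313–314 [PDF 57–58] (*"ρ_{k+1}(v, ψ) = Σ_{{X_{ω′}}} ∫Π_{j=0}^{k} du^{(j)}|_{Λ^{(j)c*}_{10}} ρ′_{k+1}(v, ψ, {X_{ω′}}, {u^{(j)}}) … which is in the form of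
our original induction hypothesis, (4.1)"*): **THE DENSITY AS A FUNCTION OF `(v, ψ)` — THE `v`-DISINTEGRATION OF THE §5 DISPLAYS, WITH THE LARGE-FIELD
CUT-OFFS.**  This seat's gens 5–11 typed and proved the displays of Sect. 5 at MEASURE LEVEL in TESTED form (`IsDT`, `IsDC`, `IsDF`, `IsR41T`: both sides
integrated against a bounded measurable `g(v, ψ)`), because with a cut-off `Λ_t ≠ T` the block field of the display is `v′` on `Λ_t` and `Qu^{(k)}` off `Λ_t`
(the surviving `δ_{Λ^{(k)′*c}_1}(v/Qu^{(k)})`).  Here it is PROVED that the tested displays ARE function identities: gen 8's whole-lattice translation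
`u = u′(ũ)·Q^{s*}ṽ` ((5.3.1) with `Λ = T`, `BIJ88RT53DensityForm`) composed with the cut-off variable gives, for EVERY block field `v`, the fibre variable
`u^{(k)} = u′(ũ)·Q^{s*}(Λ_tᶜ v)` — block averages `1` on `Λ_t` and `v` off `Λ_t`, i.e. both δ-functions of line 1 of (5.9.6) hold identically on the fibre —
and the density at `(v, ψ)` is the integral over the fibre.  (The owner's recorded gap for row C2.Claim@313, r16 gen 11 2026-08-22T03:22:11Z: *"the
v-disintegration to r18's rho at k+1"*.)

statement-level skeleton of published theorems with citation tags; proofs where landed; nothing here is a claim about the Yang–Mills mass gap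

PDF held: `paper:balaban1988-cmp114-bij-abelian-higgs-effective-action` (journal page = PDF page + 256); pp. 273–274, 280, 297, 300–303, 313–314 [PDF 17–18, 24,
41, 44–47, 57–58] re-read this session (text layer `lit read … --pages 18-20,57-58`; renders `HOME/lit-balaban-p02/pages/original-p04{4,5}-x2.png`,
`HOME/lit-balaban-p34/c2-p057-x2.png` read as images).
CITATION HEADER (lean-in-tree rule).  Part of the lit-balaban TYPED SKELETON (HOME `run/shared/lean/pub/lit-balaban/`), PHASE-2 proof seat p34 gen 11
(unit `lit-balaban-p34-g11`; free-target protocol G.5-34(d), own lineage = the C1/C2 renormalization-transformation line at measure level, gens 5–11: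
`BIJ88RT5*`, `BIJ88Eq531Transl*`, `BIJ88Eq596*`, `BIJ88Eq5128*`, `BIJ88FinalForm313`).  Rows served (owner r16, `HOME/lit-balaban-r16/ROWS-C2-part2.md`):
**C2.Claim@313** (the RESULT as a FUNCTION in r18's (4.1)-shape at `k + 1`: `result41_ae_eq`), **C2.Eq5.9.6** (line 1 as a function: `isDT_ae_eq_fibre`,
`rho596_ae_eq_form41`), **C2.Eq5.12.8** ((5.12.8) as a function: `isDT_ae_eq_cond`); support `C2.Eq5.3.1-5.3.7`, r18's `C2.Eq4.1`.

THE PRINTED TEXT (verbatim).  p. 280 [24]: *"The first translation is done in Λ₁^{(k)*}, and it removes the v-field from the δ-functions there. As in (3.24)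
we put u = u′(Λ₁^{(k)*}Q^{s*}v), (5.3.1)"*.  p. 297 [41], line 1 of (5.9.6): *"ρ^L_{k+1}(v, ψ) = Σ_{{X_ω}} Σ_{Λ₀^{(k)}} ∫du^{(k)}dφ^{(k)} δ_{Ax}(u^{(k)})
δ_{Λ₁^{(k)′*c}}(v/Qu^{(k)}) δ_{Λ₁^{(k)′*}}((e_k/2π)QA^{(k)}) ∫Π_{j=0}^{k−1}du^{(j)}|… (…)"*.  p. 303 [47], (5.12.8): *"ρ^L_{k+1}(v, ψ) = Σ_{{X_ω},Λ₀^{(k)},S₁,…}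
∫Π_{j=0}^{k} du^{(j)}|_{Λ^{(j)c*}_{10}} dφ^{(k)}|_{Λ^{(k)c}_{10}} (…) ∫dμ^{(k)}_{Λ^{(k)}_{10}} (…)"*.  p. 274 [18]: *"The measure du^{(j)} is the normalized measure on
G(1), ∫du^{(j)} = 1."*  pp. 313–314 [57–58]: the RESULT display quoted above, *"which is in the form of our original induction hypothesis, (4.1)"*.

THE READING (carriers of record; nothing re-declared).  `ν` = the law of the fine gauge field (`𝒟u δ_{Ax}` = r18's `axialMeasure` = `Π_b axialLaw_b`, or
`𝒟u` = `fieldMeasure`), a substitution-invariant probability law; `u′ = uPrime`, `u·Q^{s*}w = surfMul u w`, `Q = qU` ([2] (2.10), r18); p31's `cutoff Λ`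
(`v` on `Λ`, `1` off `Λ`) and its complement `cutoff Λᶜ` (`1` on `Λ`, `v` off `Λ`); gen 9's `uCut`/`vCut`/`IsDT`; gen 10's `Interior`/`cfgMeasure`/`extMeasure`/
`normW`/`condW` (the conditioning of Sect. 5.12) and `cfg41` (the (4.1)-coordinates `({u^{(j)}}_{j≤k}, φ^{(k)}|_{ext})`, the `k`-th previous field axial-gauge-
fixed); `Π_{j≤k}𝒟u^{(j)}` = r18's `prevMeasure P (k+1)`.  THE FIBRE BRACKET: for fixed `(v, ψ)` the bracket `J_t({u^{(j)}}, u^{(k)}, v, φ, ψ)` of line 1 of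
(5.9.6) evaluated at `u^{(k)} = u′(ũ)·Q^{s*}(Λ_tᶜ v)`, a function of the raw fluctuation variables `q̃ = (ũ, {u^{(j)}}, φ^{(k)}) ~ ν ⊗ Π𝒟u^{(j)} ⊗ 𝒟φ`; it is
gen 10's `readEntry` at the translated configuration (`fibre_bracket_eq_readEntry`).  The factorization hypothesis `hfac` of §5–§6 is the pointwise
factorization (5.12.1)–(5.12.7) of this fibre bracket — at FIXED `v`, as in print (`ρ_{k+1}(v, ψ)` is a function there) — in gen 10's interior/exterior
split of the raw variables (`Interior.freeze`); print's interior gauge variables are the constrained `u^{(k)}|_{Λ^{(k)*}_{10}}` (the chart question of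
HOME/GAPS.md G-C2-23 is untouched here).

WHAT IS PROVED (kernel-checked; theorems only — no `def`, no `Prop`-valued fact; standard axioms; imports Literature + Mathlib only).
* §1 the fibre variable: `uCut_surfMul_uPrime` (`(u′(ũ)·Q^{s*}v)′_Λ = u′(ũ)·Q^{s*}(Λᶜ v)`), `qU_fibre` (block averages `1` on `Λ`, `v` off `Λ`),
  `vCut_surfMul_uPrime` (`v_Λ(u′(ũ)·Q^{s*}v, v) = v`), measurability.
* §2 `isRDG_ae_eq_transl`: gen 8's `isRD_ae_eq_transl` for a GENERAL one-integrand display `IsRDG` (applied to `G/γ·γ`, `γ` the positive Gaussian (3.11)).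
* §3 **`isDT_ae_eq_fibre`**: `IsDT ν terms Λ Q J ρ̃`, brackets integrable in the untranslated variable, `ρ̃` integrable ⟹ `ρ̃(v, ψ) = Σ_t ∫ J_t({u^{(j)}},
  u′(ũ)·Q^{s*}(Λ_tᶜ v), v, φ, ψ) d(ν ⊗ Π𝒟u^{(j)} ⊗ 𝒟φ)` for `dv dψ`-a.e. `(v, ψ)` (`BIJ88Eq596Passage.isRDG_of_isDT`, §2, §1, gen 5's uniqueness inside); the
  iterated form; `ae_integrable_fibre` (the fibre integrand is integrable for a.e. `(v, ψ)`); `rdt_ae_eq_fibre` (this seat's Radon–Nikodym object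
  `BIJ88Eq596Exists.rdt` IS the explicit fibre integral).
* §4 **`isDT_axial_ae_eq_form41`** / `isDT_field_ae_eq_form41`: for `ν = 𝒟u δ_{Ax}` / `𝒟u` the fibre integral in the (4.1)-coordinates — `ρ̃(v, ψ) = Σ_t
  ∫_{Π_{j≤k}𝒟u^{(j)}} ∫𝒟φ^{(k)} J_t({u^{(j)}}_{j<k}, (u^{(k)}[Ax := 1])′·Q^{s*}(Λ_tᶜ v), v, φ^{(k)}, ψ)` over r18's `prevMeasure P (k+1)` (`du^{(k)}` NORMALIZED HAAR, the
  axial gauge fixing inside the integrand: `measurePreserving_fixBonds_prod`, gen 8's `integral_triple_eq_prevMeasure_succ`); **`rho596_ae_eq_form41`**: the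
  constructed `ρ^L_{k+1}` of (5.9.6) (`BIJ88Eq596Density.rho596`) as this explicit function — hypotheses: the standing range and bracket integrability only.
* §5 **`integral_cfg_condition`** (the p. 300 conditioning identity for ONE configuration integral, plain integrals: `BIJ88Eq5128CondExpect.integral_condition_
  of_measurePreserving` along `BIJ88Eq5128Split`), **`isDT_ae_eq_cond`** = (5.12.8) AS A FUNCTION: `ρ̃(v, ψ) = Σ_t ∫_{ext_t} Xf_t·𝒩_t·(∫B_t dμ^{(k)}_{Λ_{10}})` a.e.,
  from `IsDT (Π_b m_b)` and the fibre factorization; NO locality hypothesis on `Q` (the block field is the parameter `v`, not a function of the integration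
  variable — contrast gen 10's tested `BIJ88Eq5128Frame.isDC_of_isDT`, hypothesis `hv`).
* §6 **`result41_ae_eq`** — THE RESULT AS A FUNCTION: from `IsDT (𝒟u δ_{Ax})`, the fibre factorization and weight data (Sect. 5.12), the VALUE identity `hC` of
  the conditional interior integral (Sects. 5.13–5.15: `∫B_t dμ_cond = Σ_{c : π c = t} C_c`, `ext`-integrable measurable products) and the hole-family map:
  `ρ̃(v, ψ) = Σ_{ω ∈ holes} Σ_{c : hole c = ω} ∫_{Π_{j≤k}𝒟u^{(j)} ⊗ dφ^{(k)}|_{ext}} (Xf·𝒩·C_c)(cfg41_c r; v, ψ) dr` for `dv dψ`-a.e. `(v, ψ)` — the printed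
  `ρ_{k+1}(v, ψ) = Σ_{{X_{ω′}}} ∫Π_{j≤k}du^{(j)} ρ′_{k+1}` as an identity of functions over r18's `prevMeasure P (k+1)` (the tested twin is
  `BIJ88FinalForm313.result313_of_isDT`).
NOT DONE HERE (honest scope).  The factorization of the hole sum `Σ_{c : hole c = ω}` into `Π_{ω′}g_{k+1}(X_{ω′})` × global factors ((5.15.4)), the packaging
into r18's `Term41` record at `k + 1` ((4.2)–(4.9) at `k + 1`: rows C2.Eq5.15.3/5.15.4), the chart of the constrained interior gauge variables (G-C2-23), the
`A`-variables / Jacobian of (5.3.7), any bound.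
-/

namespace Literature.MathematicalPhysics.QuantumFieldTheory.BalabanImbrieJaffe1984to88.BIJ88Eq596FibreIntegral

open Literature.MathematicalPhysics.QuantumFieldTheory.Balaban1983to89
open BIJ88Sect3Statements (U1)
open BIJ85Sect1Model (HiggsField)
open BIJ88RenormTransf311 (axialMeasure axialBonds gaussWeight gaussWeight_pos)
open BIJ88InductiveForm41 (Prev prevMeasure)
open T4AxialGaugeFixing (fixBonds measurable_fixBonds)
open BIJ85BlockAveragesTorus (qU surfMul uPrime measurable_qU map_surfMul_fieldMeasure map_qU_fieldMeasure absolutelyContinuous_map_qU)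
open BIJ88Eq536Linearization (cutoff)
open BIJ88Eq531TranslLaw (qU_surfMul_uPrime axialMeasure_map_surfMul surfMul_surfMul measurable_uPrime measurable_surfMul₂)
open BIJ88Eq531TranslLawCutoff (cutoff_apply measurable_cutoff)
open BIJ88RT52Restrictions (Fields fieldsMeasure IsRD integral_fieldsMeasure)
open BIJ88RT53DensityForm (measurePreserving_transl₅ isRD_ae_eq_transl integral_triple_eq_prevMeasure_succ)
open BIJ88RT51Unique (ae_eq_of_forall_test)
open BIJ88Eq596Display (uCut vCut uCut_def IsRDG IsDT isRD_iff_isRDG)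
open BIJ88Eq596Passage (isRDG_of_isDT)
open BIJ88Eq596Exists (rdt isDT_rdt integrable_rdt isDT_iff_ae_eq_rdt)
open BIJ88Eq596Density (rho596 isDT_rho596 integrable_rho596)
open BIJ88Eq5128CondExpect (condNorm condMeasure condNorm_pos integral_condition_of_measurePreserving)
open BIJ88Eq5128Split (Cfg UCfg PCfg cfgMeasure prevPi prevMeasure_eq_prevPi Interior)
open BIJ88Eq5128Display (axialLaw axialMeasure_eq_pi_axialLaw fieldMeasure_eq_pi_haar readEntry)
open BIJ88Eq5128Display.Weight (normW condW normW_glue integral_condW_glue)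
open BIJ88Eq5128Frame (isDT_axial_iff)
open BIJ88FinalForm313 (cfg41 measurable_cfg41 integral_extMeasure_axial)
open scoped BigOperators ENNReal
open _root_.MeasureTheory _root_.MeasureTheory.Measure Complex Function

noncomputable section

variable {P : Params} {k : ℕ}

/-! ## §1 The fibre variable `u′(u)·Q^{s*}(Λᶜ v)` -/

/-- kernel: **the translated variable with cut-off of a fully translated field** — `(u′(ũ)·Q^{s*}ṽ)′_Λ = u′(ũ)·Q^{s*}(Λᶜ ṽ)`: on `Λ` the block
averages are divided out (`1`), off `Λ` the substituted block field survives. [cite: BalabanImbrieJaffe1988, (5.3.6) p.280] -/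
theorem uCut_surfMul_uPrime (hk : k + 1 ≤ P.m + P.K) (Λ : Finset (PBond P (k+1))) (U : GaugeField P k U1) (v : GaugeField P (k+1) U1) :
    uCut qU Λ (surfMul (uPrime U) v) = surfMul (uPrime U) (cutoff Λᶜ v) := by
  rw [uCut_def, qU_surfMul_uPrime hk, surfMul_surfMul]
  congr 1
  funext c
  by_cases hc : c ∈ Λ
  · rw [cutoff_apply, if_pos hc, cutoff_apply, if_neg (fun h => (Finset.mem_compl.mp h) hc)]
    exact mul_inv_cancel _
  · rw [cutoff_apply, if_neg hc, cutoff_apply, if_pos (Finset.mem_compl.mpr hc), mul_one]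

/-- kernel: the block averages of the fibre variable — `1` on `Λ`, `v` off `Λ` (the δ-functions `δ_{Λ}(Qu^{(k)})`, `δ_{Λᶜ}(v/Qu^{(k)})` of line 1 of
(5.9.6) hold identically on the fibre). [cite: BalabanImbrieJaffe1988, (5.9.6) p.297] -/
theorem qU_fibre (hk : k + 1 ≤ P.m + P.K) (Λ : Finset (PBond P (k+1))) (U : GaugeField P k U1) (v : GaugeField P (k+1) U1) :
    qU (surfMul (uPrime U) (cutoff Λᶜ v)) = fun c => if c ∈ Λ then 1 else v c := by
  rw [qU_surfMul_uPrime hk]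
  funext c
  by_cases hc : c ∈ Λ
  · rw [cutoff_apply, if_neg (fun h => (Finset.mem_compl.mp h) hc), if_pos hc]
  · rw [cutoff_apply, if_pos (Finset.mem_compl.mpr hc), if_neg hc]

/-- kernel: the block field of the translated display on the fibre is `v` itself: `v_Λ(u′(ũ)·Q^{s*}v, v) = v`. [cite: BalabanImbrieJaffe1988, (5.9.6) p.297] -/
theorem vCut_surfMul_uPrime (hk : k + 1 ≤ P.m + P.K) (Λ : Finset (PBond P (k+1))) (U : GaugeField P k U1) (v : GaugeField P (k+1) U1) :
    vCut qU Λ (surfMul (uPrime U) v) v = v := by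
  funext c
  rw [BIJ88Eq596Display.vCut_apply, qU_surfMul_uPrime hk]
  split_ifs <;> rfl

/-- kernel: **the fibre bracket is gen 10's `readEntry` at the translated configuration** — `J_t({u^{(j)}}, u′(ũ)·Q^{s*}(Λ_tᶜ v), v, φ, ψ) =
readEntry Λ Q J t ((u′(ũ)·Q^{s*}v, {u^{(j)}}, φ)) v ψ` (the bracket read through `uCut`/`vCut`). [cite: BalabanImbrieJaffe1988, (5.12.8) p.303] -/
theorem fibre_bracket_eq_readEntry {ι : Type*} (hk : k + 1 ≤ P.m + P.K) (Λ : ι → Finset (PBond P (k+1)))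
    (J : ι → Prev P k → GaugeField P k U1 → GaugeField P (k+1) U1 → HiggsField P k → HiggsField P (k+1) → ℂ) (t : ι) (q : Cfg P k)
    (v : GaugeField P (k+1) U1) (ψ : HiggsField P (k+1)) :
    J t q.2.1 (surfMul (uPrime q.1) (cutoff (Λ t)ᶜ v)) v q.2.2 ψ = readEntry Λ qU J t (surfMul (uPrime q.1) v, q.2) v ψ := by
  rw [readEntry, uCut_surfMul_uPrime hk, vCut_surfMul_uPrime hk]

/-- kernel: a substitution `u(a)·Q^{s*}w(a)` with measurable arguments is measurable (gen 7's `measurable_surfMul₂`, composed). [cite: BalabanImbrieJaffe1985, (3.9) p.307] -/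
theorem measurable_surfMul_comp {α : Type*} [MeasurableSpace α] {f : α → GaugeField P k U1} {g : α → GaugeField P (k+1) U1}
    (hf : Measurable f) (hg : Measurable g) : Measurable fun a => surfMul (f a) (g a) :=
  measurable_surfMul₂.comp (hf.prodMk hg)

/-- kernel: the fibre variable is jointly measurable in `(u, v)`. [cite: BalabanImbrieJaffe1988, (5.3.1) p.280] -/
theorem measurable_fibre (Λ : Finset (PBond P (k+1))) :
    Measurable fun p : GaugeField P k U1 × GaugeField P (k+1) U1 => surfMul (uPrime p.1) (cutoff Λᶜ p.2) :=
  measurable_surfMul_comp (measurable_uPrime.comp measurable_fst) ((measurable_cutoff _).comp measurable_snd)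

/-! ## §2 The one-integrand display as a fibre integral (gen 8's theorem for a general integrand) -/

section RDG

variable {ι : Type*} {terms : Finset ι} {ν : Measure (GaugeField P k U1)} [IsProbabilityMeasure ν]
variable {G : ι → Prev P k → GaugeField P k U1 → HiggsField P k → HiggsField P (k+1) → ℂ}
variable {ρL : GaugeField P (k+1) U1 → HiggsField P (k+1) → ℂ}

/-- **Gen 8's fibre-integral theorem for a GENERAL one-integrand display**: `IsRDG ν terms Q G ρ̃`, `fieldsMeasure ν`-integrable `G_t`, `ρ̃` `dv dψ`-integrable
⟹ `ρ̃(v, ψ) = Σ_t ∫ G_t({u^{(j)}}, u′(u)·Q^{s*}v, φ, ψ) d(ν ⊗ Π𝒟u^{(j)} ⊗ 𝒟φ)` a.e. (gen 8's `isRD_ae_eq_transl`, stated for integrands `ρ_t·gaussWeight`, applied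
to `ρ_t := G_t/γ` with the positive Gaussian `γ = gaussWeight a 0` of (3.11); standing range). [cite: BalabanImbrieJaffe1988, (5.3.6) p.280] -/
theorem isRDG_ae_eq_transl (hk : k + 1 ≤ P.m + P.K) (hν : ∀ w, ν.map (fun U => surfMul U w) = ν) (h : IsRDG ν terms qU G ρL)
    (hGi : ∀ t ∈ terms, Integrable (fun q : Fields P k => G t q.2.1 q.1 q.2.2.1 q.2.2.2) (fieldsMeasure ν))
    (hi : Integrable (uncurry ρL) ((fieldMeasure P (k+1) U1).prod volume)) :
    uncurry ρL =ᵐ[(fieldMeasure P (k+1) U1).prod volume]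
      uncurry (fun v ψ => ∑ t ∈ terms, ∫ q, G t q.2.1 (surfMul (uPrime q.1) v) q.2.2 ψ ∂ν.prod ((prevMeasure P k).prod volume)) := by
  -- the Gaussian of (3.11) at centre `0`, coupling `0`: a positive function of `ψ`
  have hγ0 : ∀ ψ : HiggsField P (k+1), ((gaussWeight (0 : ℝ) (0 : HiggsField P (k+1)) ψ : ℝ) : ℂ) ≠ 0 := fun ψ =>
    Complex.ofReal_ne_zero.mpr (ne_of_gt (gaussWeight_pos _ _ _))
  have hdiv : ∀ (z : ℂ) (ψ : HiggsField P (k+1)),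
      z / ((gaussWeight (0 : ℝ) (0 : HiggsField P (k+1)) ψ : ℝ) : ℂ) * ((gaussWeight (0 : ℝ) (0 : HiggsField P (k+1)) ψ : ℝ) : ℂ) = z :=
    fun z ψ => div_mul_cancel₀ z (hγ0 ψ)
  -- the display for `ρ_t := G_t/γ`, `Qφ := 0`, `a := 0`
  have h' : IsRD ν terms qU (fun _ _ _ _ => (0 : HiggsField P (k+1))) 0
      (fun t prev U φ ψ => G t prev U φ ψ / ((gaussWeight (0 : ℝ) (0 : HiggsField P (k+1)) ψ : ℝ) : ℂ)) ρL := by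
    rw [isRD_iff_isRDG]
    exact h.congr fun t _ prev U φ ψ => hdiv _ _
  have key := isRD_ae_eq_transl (Qφ := fun _ _ _ _ => (0 : HiggsField P (k+1))) (a := 0)
    (ρ := fun t prev U φ ψ => G t prev U φ ψ / ((gaussWeight (0 : ℝ) (0 : HiggsField P (k+1)) ψ : ℝ) : ℂ)) hk hν h'
    (fun t ht => (hGi t ht).congr (ae_of_all _ fun q => (hdiv _ _).symm)) hi
  filter_upwards [key] with z hz
  rw [hz]
  simp only [uncurry]
  refine Finset.sum_congr rfl fun t _ => integral_congr_ae (ae_of_all _ fun q => ?_)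
  exact hdiv _ _

end RDG

/-! ## §3 Line 1 of (5.9.6) as a fibre integral: the `v`-disintegration with cut-offs -/

section DT

variable {ι : Type*} {terms : Finset ι} {ν : Measure (GaugeField P k U1)} [IsProbabilityMeasure ν]
variable {Λ : ι → Finset (PBond P (k+1))}
variable {J : ι → Prev P k → GaugeField P k U1 → GaugeField P (k+1) U1 → HiggsField P k → HiggsField P (k+1) → ℂ}
variable {ρL : GaugeField P (k+1) U1 → HiggsField P (k+1) → ℂ}

omit [IsProbabilityMeasure ν] in
/-- kernel: three-fold Fubini in the nesting order. [folklore] -/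
private theorem integral_prod₃ [SFinite ν] {E : Type*} [NormedAddCommGroup E] [NormedSpace ℝ E]
    {F : GaugeField P k U1 × (Prev P k × HiggsField P k) → E}
    (hF : Integrable F (ν.prod ((prevMeasure P k).prod (volume : Measure (HiggsField P k))))) :
    ∫ q, F q ∂ν.prod ((prevMeasure P k).prod (volume : Measure (HiggsField P k))) =
      ∫ U, ∫ prev, ∫ φ, F (U, (prev, φ)) ∂volume ∂prevMeasure P k ∂ν := by
  rw [integral_prod _ hF]
  refine integral_congr_ae ?_
  filter_upwards [hF.prod_right_ae] with U hU
  rw [integral_prod _ hU]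

/-- **THE `v`-DISINTEGRATION OF LINE 1 OF (5.9.6) (large-field regions and cut-offs INCLUDED): the density is an explicit fibre integral.**  If `ρ̃`
satisfies line 1 of (5.9.6), `IsDT ν terms Λ Q J ρ̃` — *"∫du^{(k)}… δ_{Ax}(u^{(k)}) δ_{Λ₁^{(k)′*c}}(v/Qu^{(k)}) δ_{Λ₁^{(k)′*}}((e_k/2π)QA^{(k)}) ∫Π_{j<k}du^{(j)} (…)"*
in the push-forward reading — for a substitution-invariant probability law `ν` of `u` (`𝒟u δ_{Ax}`, `𝒟u`), with brackets integrable in the untranslated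
variable and `ρ̃` `dv dψ`-integrable, then for `dv dψ`-a.e. `(v, ψ)`
`ρ̃(v, ψ) = Σ_t ∫ J_t({u^{(j)}}, u′(ũ)·Q^{s*}(Λ_tᶜ v), v, φ, ψ) d(ν ⊗ Π𝒟u^{(j)} ⊗ 𝒟φ)(ũ, {u^{(j)}}, φ)`:
for EVERY `v` the variable `u^{(k)} = u′(ũ)·Q^{s*}(Λ_tᶜ v)` runs over the fibre `{Q u^{(k)} = 1 on Λ_t, = v off Λ_t}` on which both δ-functions of `v/Qu^{(k)}`
hold identically (`qU_fibre`) — *"it removes the v-field from the δ-functions"* (p. 280) now on the whole lattice, the cut-off moving into the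
substituted block field.  (`isRDG_of_isDT`: the display read in the untranslated variable; `isRDG_ae_eq_transl`: gen 8's whole-lattice translation;
`(u′(ũ)·Q^{s*}v)′_{Λ} = u′(ũ)·Q^{s*}(Λᶜ v)`, `Q(u′(ũ)·Q^{s*}v) = v`; standing range.) [cite: BalabanImbrieJaffe1988, (5.9.6) p.297] -/
theorem isDT_ae_eq_fibre (hk : k + 1 ≤ P.m + P.K) (hν : ∀ w, ν.map (fun U => surfMul U w) = ν) (h : IsDT ν terms Λ qU J ρL)
    (hJi : ∀ t ∈ terms, Integrable (fun q : Fields P k => J t q.2.1 (uCut qU (Λ t) q.1) (qU q.1) q.2.2.1 q.2.2.2) (fieldsMeasure ν))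
    (hi : Integrable (uncurry ρL) ((fieldMeasure P (k+1) U1).prod volume)) :
    uncurry ρL =ᵐ[(fieldMeasure P (k+1) U1).prod volume]
      uncurry (fun v ψ => ∑ t ∈ terms, ∫ q, J t q.2.1 (surfMul (uPrime q.1) (cutoff (Λ t)ᶜ v)) v q.2.2 ψ ∂ν.prod ((prevMeasure P k).prod volume)) := by
  filter_upwards [isRDG_ae_eq_transl hk hν (isRDG_of_isDT hk hν h hJi) hJi hi] with z hz
  rw [hz]
  simp only [uncurry, uCut_surfMul_uPrime hk, qU_surfMul_uPrime hk]

/-- kernel: the fibre integrand of one term, pulled back along gen 8's reshuffle-and-translate map `Ξ`, is integrable on `(dv ⊗ dψ) ⊗ (ν ⊗ Π𝒟u^{(j)} ⊗ 𝒟φ)`;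
hence for `dv dψ`-a.e. `(v, ψ)` the fibre integrand is `ν ⊗ Π𝒟u^{(j)} ⊗ 𝒟φ`-integrable. [cite: BalabanImbrieJaffe1988, (5.9.6) p.297] -/
theorem ae_integrable_fibre (hk : k + 1 ≤ P.m + P.K) (hν : ∀ w, ν.map (fun U => surfMul U w) = ν) {t : ι}
    (hJt : Integrable (fun q : Fields P k => J t q.2.1 (uCut qU (Λ t) q.1) (qU q.1) q.2.2.1 q.2.2.2) (fieldsMeasure ν)) :
    ∀ᵐ z : GaugeField P (k+1) U1 × HiggsField P (k+1) ∂(fieldMeasure P (k+1) U1).prod volume,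
      Integrable (fun q : GaugeField P k U1 × (Prev P k × HiggsField P k) => J t q.2.1 (surfMul (uPrime q.1) (cutoff (Λ t)ᶜ z.1)) z.1 q.2.2 z.2)
        (ν.prod ((prevMeasure P k).prod volume)) := by
  have hΞ := measurePreserving_transl₅ (P := P) (k := k) hk hν
  have hKΞ : Integrable (fun r : (GaugeField P (k+1) U1 × HiggsField P (k+1)) × (GaugeField P k U1 × (Prev P k × HiggsField P k)) =>
      J t r.2.2.1 (uCut qU (Λ t) (surfMul (uPrime r.2.1) r.1.1)) (qU (surfMul (uPrime r.2.1) r.1.1)) r.2.2.2 r.1.2)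
      (((fieldMeasure P (k+1) U1).prod volume).prod (ν.prod ((prevMeasure P k).prod volume))) :=
    (hΞ.integrable_comp hJt.aestronglyMeasurable).2 hJt
  have hKΞ' : Integrable (fun r : (GaugeField P (k+1) U1 × HiggsField P (k+1)) × (GaugeField P k U1 × (Prev P k × HiggsField P k)) =>
      J t r.2.2.1 (surfMul (uPrime r.2.1) (cutoff (Λ t)ᶜ r.1.1)) r.1.1 r.2.2.2 r.1.2)
      (((fieldMeasure P (k+1) U1).prod volume).prod (ν.prod ((prevMeasure P k).prod volume))) := by
    simpa only [uCut_surfMul_uPrime hk, qU_surfMul_uPrime hk] using hKΞ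
  exact hKΞ'.prod_right_ae

/-- **Iterated form**: `ρ̃(v, ψ) = Σ_t ∫ν(dũ) ∫Π_{j<k}𝒟u^{(j)} ∫𝒟φ J_t({u^{(j)}}, u′(ũ)·Q^{s*}(Λ_tᶜ v), v, φ, ψ)` for `dv dψ`-a.e. `(v, ψ)`.
[cite: BalabanImbrieJaffe1988, (5.9.6) p.297] -/
theorem isDT_ae_eq_fibre_iter (hk : k + 1 ≤ P.m + P.K) (hν : ∀ w, ν.map (fun U => surfMul U w) = ν) (h : IsDT ν terms Λ qU J ρL)
    (hJi : ∀ t ∈ terms, Integrable (fun q : Fields P k => J t q.2.1 (uCut qU (Λ t) q.1) (qU q.1) q.2.2.1 q.2.2.2) (fieldsMeasure ν))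
    (hi : Integrable (uncurry ρL) ((fieldMeasure P (k+1) U1).prod volume)) :
    uncurry ρL =ᵐ[(fieldMeasure P (k+1) U1).prod volume]
      uncurry (fun v ψ => ∑ t ∈ terms, ∫ U, ∫ prev, ∫ φ, J t prev (surfMul (uPrime U) (cutoff (Λ t)ᶜ v)) v φ ψ ∂volume ∂prevMeasure P k ∂ν) := by
  have hall := (Filter.eventually_all_finset terms).2 fun t ht => ae_integrable_fibre (Λ := Λ) hk hν (hJi t ht)
  filter_upwards [isDT_ae_eq_fibre hk hν h hJi hi, hall] with z hz hiz
  rw [hz]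
  show (∑ t ∈ terms, ∫ q, J t q.2.1 (surfMul (uPrime q.1) (cutoff (Λ t)ᶜ z.1)) z.1 q.2.2 z.2 ∂ν.prod ((prevMeasure P k).prod volume)) =
    ∑ t ∈ terms, ∫ U, ∫ prev, ∫ φ, J t prev (surfMul (uPrime U) (cutoff (Λ t)ᶜ z.1)) z.1 φ z.2 ∂volume ∂prevMeasure P k ∂ν
  exact Finset.sum_congr rfl fun t ht => integral_prod₃ (hiz t ht)

/-- **The constructed density of a bracket of line 1 of (5.9.6)** (this seat's Radon–Nikodym object `BIJ88Eq596Exists.rdt`) **IS the explicit fibre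
integral**, almost everywhere (`ν` with `ν.map Q ≪ dv`; standing range). [cite: BalabanImbrieJaffe1988, (5.9.6) p.297] -/
theorem rdt_ae_eq_fibre (hk : k + 1 ≤ P.m + P.K) (hν : ∀ w, ν.map (fun U => surfMul U w) = ν) (hac : ν.map qU ≪ fieldMeasure P (k+1) U1)
    (hJ : ∀ t ∈ terms, Integrable (fun q : Fields P k => J t q.2.1 (uCut qU (Λ t) q.1) (qU q.1) q.2.2.1 q.2.2.2) (fieldsMeasure ν)) :
    uncurry (rdt ν terms Λ J) =ᵐ[(fieldMeasure P (k+1) U1).prod volume]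
      uncurry (fun v ψ => ∑ t ∈ terms, ∫ q, J t q.2.1 (surfMul (uPrime q.1) (cutoff (Λ t)ᶜ v)) v q.2.2 ψ ∂ν.prod ((prevMeasure P k).prod volume)) :=
  isDT_ae_eq_fibre hk hν (isDT_rdt hk hν hac hJ) hJ (integrable_rdt hJ)

end DT

/-! ## §4 *"in the form of our original induction hypothesis, (4.1)"* at level `k + 1`, with the large-field cut-offs -/

section Form41

variable {ι : Type*} {terms : Finset ι} {Λ : ι → Finset (PBond P (k+1))}
variable {J : ι → Prev P k → GaugeField P k U1 → GaugeField P (k+1) U1 → HiggsField P k → HiggsField P (k+1) → ℂ}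
variable {ρL : GaugeField P (k+1) U1 → HiggsField P (k+1) → ℂ}

/-- kernel: **axial gauge fixing of the fine field as a measure-preserving map on the fibre variables** — `(u, ({u^{(j)}}, φ)) ↦ (u[Ax := 1], ({u^{(j)}}, φ))`
carries `𝒟u ⊗ Π𝒟u^{(j)} ⊗ 𝒟φ` to `𝒟u δ_{Ax} ⊗ Π𝒟u^{(j)} ⊗ 𝒟φ` (r18's DEFINITION `axialMeasure = 𝒟u.map fixBonds`). [cite: BalabanImbrieJaffe1988, (3.11) p.266] -/
theorem measurePreserving_fixBonds_prod :
    MeasurePreserving (fun q : GaugeField P k U1 × (Prev P k × HiggsField P k) => (fixBonds (axialBonds : Finset (PBond P k)) q.1, q.2))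
      ((fieldMeasure P k U1).prod ((prevMeasure P k).prod (volume : Measure (HiggsField P k))))
      ((axialMeasure P k U1).prod ((prevMeasure P k).prod (volume : Measure (HiggsField P k)))) := by
  have hf : MeasurePreserving (fixBonds (axialBonds : Finset (PBond P k))) (fieldMeasure P k U1) (axialMeasure P k U1) :=
    ⟨measurable_fixBonds _, rfl⟩
  exact hf.prod (MeasurePreserving.id _)

/-- kernel: a fibre integral over `𝒟u δ_{Ax} ⊗ Π_{j<k}𝒟u^{(j)} ⊗ 𝒟φ` of an integrable `F` is the integral over r18's `Π_{j≤k}𝒟u^{(j)}` (`prevMeasure P (k+1)`: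
the fine field, axial-gauge-fixed inside `F`, has become the `k`-th previous field `u^{(k)} = ·(Fin.last k)`, `{u^{(j)}}_{j<k} = Fin.init`) of the
`𝒟φ`-integral (pull-back along `measurePreserving_fixBonds_prod`, gen 8's `integral_triple_eq_prevMeasure_succ`). [cite: BalabanImbrieJaffe1988, (4.1) p.274] -/
theorem integral_axial_triple_eq_prevMeasure_succ {E : Type*} [NormedAddCommGroup E] [NormedSpace ℝ E]
    {F : GaugeField P k U1 × (Prev P k × HiggsField P k) → E}
    (hF : Integrable F ((axialMeasure P k U1).prod ((prevMeasure P k).prod (volume : Measure (HiggsField P k))))) :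
    ∫ q, F q ∂(axialMeasure P k U1).prod ((prevMeasure P k).prod (volume : Measure (HiggsField P k))) =
      ∫ pp, ∫ φ, F (fixBonds (axialBonds : Finset (PBond P k)) (pp (Fin.last k)), (Fin.init pp, φ)) ∂volume ∂prevMeasure P (k+1) := by
  have hA := measurePreserving_fixBonds_prod (P := P) (k := k)
  have hm : AEStronglyMeasurable F (Measure.map
      (fun q : GaugeField P k U1 × (Prev P k × HiggsField P k) => (fixBonds (axialBonds : Finset (PBond P k)) q.1, q.2))
      ((fieldMeasure P k U1).prod ((prevMeasure P k).prod (volume : Measure (HiggsField P k))))) := by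
    rw [hA.map_eq]; exact hF.aestronglyMeasurable
  have hFA : Integrable (fun q : GaugeField P k U1 × (Prev P k × HiggsField P k) => F (fixBonds (axialBonds : Finset (PBond P k)) q.1, q.2))
      ((fieldMeasure P k U1).prod ((prevMeasure P k).prod (volume : Measure (HiggsField P k)))) :=
    (hA.integrable_comp hF.aestronglyMeasurable).2 hF
  rw [← hA.map_eq, integral_map hA.measurable.aemeasurable hm]
  exact integral_triple_eq_prevMeasure_succ hFA

/-- **THE DENSITY OF LINE 1 OF (5.9.6) IS OF THE INDUCTIVE FORM (4.1) AT LEVEL `k + 1`** (pp. 313–314: *"ρ_{k+1}(v, ψ) = Σ ∫Π_{j=0}^{k} du^{(j)}|… ρ′_{k+1}(v, ψ,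
{X_{ω′}}, {u^{(j)}}) … which is in the form of our original induction hypothesis, (4.1)"*; p. 274: *"The measure du^{(j)} is the normalized measure"*),
WITH the large-field regions: for `ν = 𝒟u δ_{Ax}`, every `dv dψ`-integrable `ρ̃` with `IsDT (𝒟u δ_{Ax}) terms Λ Q J ρ̃` (brackets integrable in the
untranslated variable) is `dv dψ`-a.e.
`ρ̃(v, ψ) = Σ_t ∫_{Π_{j≤k}𝒟u^{(j)}} ρ′_{k+1,t}({u^{(j)}}_{j≤k}; v, ψ)`, `ρ′_{k+1,t}({u^{(j)}}_{j≤k}; v, ψ) := ∫𝒟φ^{(k)} J_t({u^{(j)}}_{j<k}, (u^{(k)}[Ax := 1])′·Q^{s*}(Λ_tᶜ v), v,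
φ^{(k)}, ψ)` — an honest function of `(v, ψ)`, the previous fields integrated against r18's product of normalized Haar measures `prevMeasure P (k+1)`, the
dependence on `v` off the small-field region carried by the background variable (the *"quite complicated"* form of `u_{k+1}` off `Λ`, p. 274).  The term
integrand `ρ′_{k+1,t}` here is the bracket of (5.9.6) integrated over `φ^{(k)}`; its expansion (Sects. 5.10–5.15) is not performed here.
[cite: BalabanImbrieJaffe1988, (4.1) pp.313–314] -/
theorem isDT_axial_ae_eq_form41 (hk : k + 1 ≤ P.m + P.K) (h : IsDT (axialMeasure P k U1) terms Λ qU J ρL)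
    (hJi : ∀ t ∈ terms, Integrable (fun q : Fields P k => J t q.2.1 (uCut qU (Λ t) q.1) (qU q.1) q.2.2.1 q.2.2.2) (fieldsMeasure (axialMeasure P k U1)))
    (hi : Integrable (uncurry ρL) ((fieldMeasure P (k+1) U1).prod volume)) :
    uncurry ρL =ᵐ[(fieldMeasure P (k+1) U1).prod volume]
      uncurry (fun v ψ => ∑ t ∈ terms, ∫ pp, ∫ φ,
        J t (Fin.init pp) (surfMul (uPrime (fixBonds (axialBonds : Finset (PBond P k)) (pp (Fin.last k)))) (cutoff (Λ t)ᶜ v)) v φ ψ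
        ∂volume ∂prevMeasure P (k+1)) := by
  have hall := (Filter.eventually_all_finset terms).2 fun t ht => ae_integrable_fibre (Λ := Λ) hk axialMeasure_map_surfMul (hJi t ht)
  filter_upwards [isDT_ae_eq_fibre hk axialMeasure_map_surfMul h hJi hi, hall] with z hz hiz
  rw [hz]
  show (∑ t ∈ terms, ∫ q, J t q.2.1 (surfMul (uPrime q.1) (cutoff (Λ t)ᶜ z.1)) z.1 q.2.2 z.2 ∂(axialMeasure P k U1).prod ((prevMeasure P k).prod volume)) =
    ∑ t ∈ terms, ∫ pp, ∫ φ, J t (Fin.init pp) (surfMul (uPrime (fixBonds (axialBonds : Finset (PBond P k)) (pp (Fin.last k)))) (cutoff (Λ t)ᶜ z.1)) z.1 φ z.2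
      ∂volume ∂prevMeasure P (k+1)
  exact Finset.sum_congr rfl fun t ht => integral_axial_triple_eq_prevMeasure_succ (hiz t ht)

/-- **Instance `ν = 𝒟u`** (no axial gauge fixing of the fine field): `ρ̃(v, ψ) = Σ_t ∫_{Π_{j≤k}𝒟u^{(j)}} ∫𝒟φ^{(k)} J_t({u^{(j)}}_{j<k}, u^{(k)′}·Q^{s*}(Λ_tᶜ v), v, φ^{(k)}, ψ)`
a.e. (gen 8's `integral_triple_eq_prevMeasure_succ`). [cite: BalabanImbrieJaffe1988, (4.1) pp.313–314] -/
theorem isDT_field_ae_eq_form41 (hk : k + 1 ≤ P.m + P.K) (h : IsDT (fieldMeasure P k U1) terms Λ qU J ρL)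
    (hJi : ∀ t ∈ terms, Integrable (fun q : Fields P k => J t q.2.1 (uCut qU (Λ t) q.1) (qU q.1) q.2.2.1 q.2.2.2) (fieldsMeasure (fieldMeasure P k U1)))
    (hi : Integrable (uncurry ρL) ((fieldMeasure P (k+1) U1).prod volume)) :
    uncurry ρL =ᵐ[(fieldMeasure P (k+1) U1).prod volume]
      uncurry (fun v ψ => ∑ t ∈ terms, ∫ pp, ∫ φ,
        J t (Fin.init pp) (surfMul (uPrime (pp (Fin.last k))) (cutoff (Λ t)ᶜ v)) v φ ψ ∂volume ∂prevMeasure P (k+1)) := by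
  have hall := (Filter.eventually_all_finset terms).2 fun t ht => ae_integrable_fibre (Λ := Λ) hk map_surfMul_fieldMeasure (hJi t ht)
  filter_upwards [isDT_ae_eq_fibre hk map_surfMul_fieldMeasure h hJi hi, hall] with z hz hiz
  rw [hz]
  show (∑ t ∈ terms, ∫ q, J t q.2.1 (surfMul (uPrime q.1) (cutoff (Λ t)ᶜ z.1)) z.1 q.2.2 z.2 ∂(fieldMeasure P k U1).prod ((prevMeasure P k).prod volume)) =
    ∑ t ∈ terms, ∫ pp, ∫ φ, J t (Fin.init pp) (surfMul (uPrime (pp (Fin.last k))) (cutoff (Λ t)ᶜ z.1)) z.1 φ z.2 ∂volume ∂prevMeasure P (k+1)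
  exact Finset.sum_congr rfl fun t ht => integral_triple_eq_prevMeasure_succ (hiz t ht)

/-- **`ρ^L_{k+1}` OF (5.9.6) AS A FUNCTION**: this seat's constructed density `BIJ88Eq596Density.rho596 terms Λ J₂` (the object satisfying line 1 of (5.9.6)
with the renamed bracket `J₂` over `∫𝒟u δ_{Ax}`, unique a.e.) equals, `dv dψ`-a.e.,
`(v, ψ) ↦ Σ_t ∫_{Π_{j≤k}𝒟u^{(j)}} ∫𝒟φ^{(k)} J₂,t({u^{(j)}}_{j<k}, (u^{(k)}[Ax := 1])′·Q^{s*}(Λ_tᶜ v), v, φ^{(k)}, ψ)` — hypotheses: the standing range and the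
integrability of the brackets in the untranslated variable, nothing else. [cite: BalabanImbrieJaffe1988, (5.9.6) p.297] -/
theorem rho596_ae_eq_form41 (hk : k + 1 ≤ P.m + P.K)
    (hJ : ∀ t ∈ terms, Integrable (fun q : Fields P k => J t q.2.1 (uCut qU (Λ t) q.1) (qU q.1) q.2.2.1 q.2.2.2) (fieldsMeasure (axialMeasure P k U1))) :
    uncurry (rho596 terms Λ J) =ᵐ[(fieldMeasure P (k+1) U1).prod volume]
      uncurry (fun v ψ => ∑ t ∈ terms, ∫ pp, ∫ φ,
        J t (Fin.init pp) (surfMul (uPrime (fixBonds (axialBonds : Finset (PBond P k)) (pp (Fin.last k)))) (cutoff (Λ t)ᶜ v)) v φ ψ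
        ∂volume ∂prevMeasure P (k+1)) :=
  isDT_axial_ae_eq_form41 hk (isDT_rho596 hk hJ) hJ (integrable_rho596 hJ)

end Form41

/-! ## §5 (5.12.8) and the RESULT pp. 313–314 AS FUNCTIONS of `(v, ψ)`: conditioning the fibre integral -/

section Cond

variable {ι : Type*} {terms : Finset ι} {Λ : ι → Finset (PBond P (k+1))}
variable {m : PBond P k → Measure U1} [∀ b, IsProbabilityMeasure (m b)]
variable {J : ι → Prev P k → GaugeField P k U1 → GaugeField P (k+1) U1 → HiggsField P k → HiggsField P (k+1) → ℂ}
variable {ρL : GaugeField P (k+1) U1 → HiggsField P (k+1) → ℂ}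

/-- **THE p. 300 CONDITIONING IDENTITY FOR ONE FIBRE INTEGRAL (plain integrals, no test function)** — *"∫dφ|_{Λᶜ} F(φ|_{Λᶜ}) ∫dφ|_Λ e^{…} G(φ) = (…)
∫dφ|_{Λᶜ} F e^{…} × (1/𝒩) ∫dφ|_Λ G e^{…}"* on the configuration space `(u^{(k)}, {u^{(j)}}, φ^{(k)}) ~ Π_b m_b ⊗ Π𝒟u^{(j)} ⊗ 𝒟φ`: an integrable `K`
factorized pointwise as (exterior factor ∘ freeze) × (positive fibre-integrable weight) × (interior factor) integrates to `∫_{ext} Xf·𝒩·(∫ B dμ_cond)`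
(`BIJ88Eq5128CondExpect.integral_condition_of_measurePreserving` along the split of `BIJ88Eq5128Split`). [cite: BalabanImbrieJaffe1988, (5.12.8) p.303] -/
theorem integral_cfg_condition (D : Interior P k) {K Xf B : Cfg P k → ℂ} {W : Cfg P k → ℝ}
    (hfac : ∀ q, K q = Xf (D.freeze q) * (W q : ℂ) * B q) (hWm : Measurable W) (hW0 : ∀ q, 0 < W q)
    (hWi : ∀ e, Integrable (fun i => W (D.glue e i)) (D.μInt m)) (hK : Integrable K (cfgMeasure (Measure.pi m))) :
    ∫ q, K q ∂cfgMeasure (Measure.pi m) = ∫ q, Xf q * (normW D m W q : ℂ) * ∫ q', B q' ∂condW D m W q ∂D.extMeasure m := by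
  have hgl : Measurable fun p : D.Ext × D.Int => D.glue p.1 p.2 := by
    simpa only [Interior.glue, Prod.mk.eta] using (D.split).symm.measurable
  have hH : ∀ q, K q = (fun e => Xf (D.glue e D.base)) (D.split q).1 * ((fun p : D.Ext × D.Int => W (D.glue p.1 p.2)) (D.split q) : ℂ) *
      (fun p : D.Ext × D.Int => B (D.glue p.1 p.2)) (D.split q) := by
    intro q
    simp only [Interior.glue_split, ← Interior.freeze_eq_glue]
    exact hfac q
  have hW'm : Measurable fun p : D.Ext × D.Int => W (D.glue p.1 p.2) := hWm.comp hgl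
  have hN : ∀ e, 0 < condNorm (D.μInt m) (fun i => W (D.glue e i)) := fun e => condNorm_pos (fun i => hW0 _) (hWi e)
  have hint : Integrable (fun p : D.Ext × D.Int => Xf (D.glue p.1 D.base) * (W (D.glue p.1 p.2) : ℂ) * B (D.glue p.1 p.2))
      ((D.μExt m).prod (D.μInt m)) := by
    refine ((D.integrable_glue_iff m (F := K)).mpr hK).congr (Filter.Eventually.of_forall fun p => ?_)
    show K (D.glue p.1 p.2) = _
    rw [hH (D.glue p.1 p.2), Interior.split_glue]
  rw [integral_condition_of_measurePreserving (D.measurePreserving_split m) (fun e => Xf (D.glue e D.base)) hW'm (fun p => (hW0 _).le) hWi hN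
    (fun p : D.Ext × D.Int => B (D.glue p.1 p.2)) hint hH, Interior.integral_extMeasure]
  refine integral_congr_ae (Filter.Eventually.of_forall fun e => ?_)
  simp only [normW_glue, integral_condW_glue]

/-- **(5.12.8) AS A FUNCTION OF `(v, ψ)` (PROVED)** — the conditioning of Sect. 5.12 applied to the fibre integral of line 1 of (5.9.6): if `ρ̃` satisfies
`IsDT (Π_b m_b) terms Λ Q J ρ̃` (substitution-invariant one-bond laws of mass one, brackets integrable in the untranslated variable, `ρ̃` integrable) and the
fibre bracket factorizes POINTWISE, `J_t({u^{(j)}}, u′(ũ)·Q^{s*}(Λ_tᶜ v), v, φ, ψ) = Xf_t(freeze q̃; v, ψ)·W_t(q̃; v, ψ)·B_t(q̃; v, ψ)` in `q̃ = (ũ, {u^{(j)}}, φ)` with a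
measurable positive fibre-integrable weight, then `dv dψ`-a.e.
`ρ̃(v, ψ) = Σ_t ∫_{ext_t} Xf_t(q; v, ψ)·𝒩_t(q; v, ψ)·(∫ B_t(q′; v, ψ) dμ^{(k)}_{Λ^{(k)}_{10},t}(q′|q)) d(ext_t)(q)` — the display (5.12.8) for the VALUE of the
density at `(v, ψ)` (exterior measures `extMeasure`, normalization `normW`, interior laws `condW` of `BIJ88Eq5128Display`/`Split`); NO locality hypothesis on
`Q` is needed (the block field is the parameter `v`). [cite: BalabanImbrieJaffe1988, (5.12.8) p.303] -/
theorem isDT_ae_eq_cond (hk : k + 1 ≤ P.m + P.K) (hν : ∀ w, (Measure.pi m).map (fun U => surfMul U w) = Measure.pi m)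
    (h : IsDT (Measure.pi m) terms Λ qU J ρL)
    (hJi : ∀ t ∈ terms, Integrable (fun q : Fields P k => J t q.2.1 (uCut qU (Λ t) q.1) (qU q.1) q.2.2.1 q.2.2.2) (fieldsMeasure (Measure.pi m)))
    (hi : Integrable (uncurry ρL) ((fieldMeasure P (k+1) U1).prod volume)) (D : ι → Interior P k)
    (Xf B : ι → Cfg P k → GaugeField P (k+1) U1 → HiggsField P (k+1) → ℂ) (W : ι → Cfg P k → GaugeField P (k+1) U1 → HiggsField P (k+1) → ℝ)
    (hfac : ∀ t ∈ terms, ∀ (q : Cfg P k) (v : GaugeField P (k+1) U1) (ψ : HiggsField P (k+1)),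
      J t q.2.1 (surfMul (uPrime q.1) (cutoff (Λ t)ᶜ v)) v q.2.2 ψ = Xf t ((D t).freeze q) v ψ * (W t q v ψ : ℂ) * B t q v ψ)
    (hWm : ∀ t ∈ terms, ∀ v ψ, Measurable fun q => W t q v ψ) (hW0 : ∀ t ∈ terms, ∀ q v ψ, 0 < W t q v ψ)
    (hWi : ∀ t ∈ terms, ∀ (e : (D t).Ext) (v : GaugeField P (k+1) U1) (ψ : HiggsField P (k+1)),
      Integrable (fun i => W t ((D t).glue e i) v ψ) ((D t).μInt m)) :
    uncurry ρL =ᵐ[(fieldMeasure P (k+1) U1).prod volume]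
      uncurry (fun v ψ => ∑ t ∈ terms, ∫ q, Xf t q v ψ * (normW (D t) m (fun q' => W t q' v ψ) q : ℂ) *
        ∫ q', B t q' v ψ ∂condW (D t) m (fun q' => W t q' v ψ) q ∂(D t).extMeasure m) := by
  -- `Π_b m_b` read on r18's carrier `GaugeField` is a probability law
  haveI : @IsProbabilityMeasure (GaugeField P k U1) inferInstance (Measure.pi m) := Measure.pi.instIsProbabilityMeasure m
  have hall := (Filter.eventually_all_finset terms).2 fun t ht => ae_integrable_fibre (Λ := Λ) hk hν (hJi t ht)
  filter_upwards [isDT_ae_eq_fibre hk hν h hJi hi, hall] with z hz hiz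
  rw [hz]
  show (∑ t ∈ terms, ∫ q, J t q.2.1 (surfMul (uPrime q.1) (cutoff (Λ t)ᶜ z.1)) z.1 q.2.2 z.2 ∂(Measure.pi m).prod ((prevMeasure P k).prod volume)) =
    ∑ t ∈ terms, ∫ q, Xf t q z.1 z.2 * (normW (D t) m (fun q' => W t q' z.1 z.2) q : ℂ) *
      ∫ q', B t q' z.1 z.2 ∂condW (D t) m (fun q' => W t q' z.1 z.2) q ∂(D t).extMeasure m
  refine Finset.sum_congr rfl fun t ht => ?_
  -- the fibre integral is the configuration integral of `BIJ88Eq5128Split` (same measure, r18's carriers)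
  have hK : Integrable (fun q : Cfg P k => J t q.2.1 (surfMul (uPrime q.1) (cutoff (Λ t)ᶜ z.1)) z.1 q.2.2 z.2) (cfgMeasure (Measure.pi m)) :=
    hiz t ht
  exact integral_cfg_condition (D t) (fun q => hfac t ht q z.1 z.2) (hWm t ht z.1 z.2) (fun q => hW0 t ht q z.1 z.2) (fun e => hWi t ht e z.1 z.2) hK

end Cond

/-! ## §6 The RESULT pp. 313–314 as a function: (4.1) at `k + 1` with the hole families -/

section Result

variable {ι ι' Ω : Type*} {terms : Finset ι} {Λ : ι → Finset (PBond P (k+1))}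
variable {J : ι → Prev P k → GaugeField P k U1 → GaugeField P (k+1) U1 → HiggsField P k → HiggsField P (k+1) → ℂ}
variable {ρL : GaugeField P (k+1) U1 → HiggsField P (k+1) → ℂ}

/-- kernel: `𝒟u δ_{Ax} = Π_b axialLaw_b` is substitution-invariant (gen 7's `axialMeasure_map_surfMul` transported). [cite: BalabanImbrieJaffe1988, (3.11) p.266] -/
theorem pi_axialLaw_map_surfMul (w : GaugeField P (k+1) U1) :
    (Measure.pi (axialLaw P k)).map (fun U => surfMul U w) = Measure.pi (axialLaw P k) := by
  rw [← axialMeasure_eq_pi_axialLaw]; exact axialMeasure_map_surfMul w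

/-- **THE RESULT pp. 313–314 AS A FUNCTION OF `(v, ψ)` (PROVED) — the `v`-disintegration of the whole §5 passage to r18's (4.1)-shape at level `k + 1`.**
From line 1 of (5.9.6) over `∫𝒟u δ_{Ax}` (`IsDT`): (i) the `v`-disintegration (§3); (ii) the conditioning of Sect. 5.12 on each fibre (factorization `hfac` of the
fibre bracket, weight data: §5); (iii) the cluster / Mayer expansions of Sects. 5.13–5.15 as the identity `hC` for the VALUE of the conditional interior integral,
`∫ B_t dμ_cond = Σ_{c : π c = t} C_c` (rows C2.Eq5.13.x–5.15.2), with `ext`-integrable inserted products; (iv) the hole-family map `hole` (*"Let {X_{ω′}} be the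
components of Λ^{(k)c}_{13}"*); (v) the exterior measures of `𝒟u δ_{Ax}` in the (4.1)-coordinates `cfg41` (`BIJ88FinalForm313.integral_extMeasure_axial`, jointly
measurable products).  CONCLUSION, for `dv dψ`-a.e. `(v, ψ)`:
`ρ̃(v, ψ) = Σ_{ω ∈ holes} Σ_{c : hole c = ω} ∫_{Π_{j≤k}𝒟u^{(j)} ⊗ dφ^{(k)}|_{ext}} (Xf·𝒩·C_c)(cfg41_c(r); v, ψ) dr` — *"ρ_{k+1}(v, ψ) = Σ_{{X_{ω′}}} ∫Π_{j=0}^{k}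
du^{(j)}|_{Λ^{(j)c*}_{10}} ρ′_{k+1}(v, ψ, {X_{ω′}}, {u^{(j)}})"*: a FUNCTION identity, the previous fields `{u^{(j)}}_{j≤k}` under r18's `prevMeasure P (k+1)` (p. 274
*"du^{(j)} is the normalized measure"*), the `k`-th one axial-gauge-fixed inside `cfg41`, the exterior `φ^{(k)}`-integral of (5.15.4) explicit; the tested form
is `BIJ88FinalForm313.result313_of_isDT`.  Not done: the factorization of `Σ_{c : hole c = ω}(…)` into `Π_{ω′}g_{k+1}(X_{ω′})` × globals, bounds.
[cite: BalabanImbrieJaffe1988, (5.15.4) p.314] -/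
theorem result41_ae_eq [DecidableEq ι] [DecidableEq Ω] (hk : k + 1 ≤ P.m + P.K) (h : IsDT (axialMeasure P k U1) terms Λ qU J ρL)
    (hJi : ∀ t ∈ terms, Integrable (fun q : Fields P k => J t q.2.1 (uCut qU (Λ t) q.1) (qU q.1) q.2.2.1 q.2.2.2) (fieldsMeasure (axialMeasure P k U1)))
    (hi : Integrable (uncurry ρL) ((fieldMeasure P (k+1) U1).prod volume)) (D : ι → Interior P k)
    (Xf B : ι → Cfg P k → GaugeField P (k+1) U1 → HiggsField P (k+1) → ℂ) (W : ι → Cfg P k → GaugeField P (k+1) U1 → HiggsField P (k+1) → ℝ)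
    (hfac : ∀ t ∈ terms, ∀ (q : Cfg P k) (v : GaugeField P (k+1) U1) (ψ : HiggsField P (k+1)),
      J t q.2.1 (surfMul (uPrime q.1) (cutoff (Λ t)ᶜ v)) v q.2.2 ψ = Xf t ((D t).freeze q) v ψ * (W t q v ψ : ℂ) * B t q v ψ)
    (hWm : ∀ t ∈ terms, ∀ v ψ, Measurable fun q => W t q v ψ) (hW0 : ∀ t ∈ terms, ∀ q v ψ, 0 < W t q v ψ)
    (hWi : ∀ t ∈ terms, ∀ (e : (D t).Ext) (v : GaugeField P (k+1) U1) (ψ : HiggsField P (k+1)),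
      Integrable (fun i => W t ((D t).glue e i) v ψ) ((D t).μInt (axialLaw P k)))
    (terms' : Finset ι') (π : ι' → ι) (hπ : ∀ c ∈ terms', π c ∈ terms)
    (C : ι' → Cfg P k → GaugeField P (k+1) U1 → HiggsField P (k+1) → ℂ)
    (hC : ∀ t ∈ terms, ∀ (q : Cfg P k) (v : GaugeField P (k+1) U1) (ψ : HiggsField P (k+1)),
      ∫ q', B t q' v ψ ∂condW (D t) (axialLaw P k) (fun q' => W t q' v ψ) q = ∑ c ∈ terms'.filter (fun c => π c = t), C c q v ψ)
    (hCi : ∀ c ∈ terms', ∀ (v : GaugeField P (k+1) U1) (ψ : HiggsField P (k+1)),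
      Integrable (fun q => Xf (π c) q v ψ * (normW (D (π c)) (axialLaw P k) (fun q' => W (π c) q' v ψ) q : ℂ) * C c q v ψ)
        ((D (π c)).extMeasure (axialLaw P k)))
    (hYm : ∀ c ∈ terms', ∀ (v : GaugeField P (k+1) U1) (ψ : HiggsField P (k+1)),
      Measurable fun q => Xf (π c) q v ψ * (normW (D (π c)) (axialLaw P k) (fun q' => W (π c) q' v ψ) q : ℂ) * C c q v ψ)
    (hole : ι' → Ω) (holes : Finset Ω) (hh : ∀ c ∈ terms', hole c ∈ holes) :
    uncurry ρL =ᵐ[(fieldMeasure P (k+1) U1).prod volume]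
      uncurry (fun v ψ => ∑ ω ∈ holes, ∑ c ∈ terms'.filter (fun c => hole c = ω),
        ∫ r, Xf (π c) (cfg41 (D (π c)) r) v ψ * (normW (D (π c)) (axialLaw P k) (fun q' => W (π c) q' v ψ) (cfg41 (D (π c)) r) : ℂ) *
          C c (cfg41 (D (π c)) r) v ψ ∂(prevMeasure P (k+1)).prod (volume : Measure (D (π c)).EX)) := by
  have h' : IsDT (Measure.pi (axialLaw P k)) terms Λ qU J ρL := isDT_axial_iff.mp h
  have hJi' : ∀ t ∈ terms, Integrable (fun q : Fields P k => J t q.2.1 (uCut qU (Λ t) q.1) (qU q.1) q.2.2.1 q.2.2.2)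
      (fieldsMeasure (Measure.pi (axialLaw P k))) := by
    rw [← axialMeasure_eq_pi_axialLaw]; exact hJi
  filter_upwards [isDT_ae_eq_cond hk pi_axialLaw_map_surfMul h' hJi' hi D Xf B W hfac hWm hW0 hWi] with z hz
  rw [hz]
  simp only [uncurry]
  -- (iii) insert the expansion of the conditional interior integral, term by term
  have e1 : ∀ t ∈ terms,
      ∫ q, Xf t q z.1 z.2 * (normW (D t) (axialLaw P k) (fun q' => W t q' z.1 z.2) q : ℂ) *
          ∫ q', B t q' z.1 z.2 ∂condW (D t) (axialLaw P k) (fun q' => W t q' z.1 z.2) q ∂(D t).extMeasure (axialLaw P k) =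
        ∑ c ∈ terms'.filter (fun c => π c = t),
          ∫ q, Xf (π c) q z.1 z.2 * (normW (D (π c)) (axialLaw P k) (fun q' => W (π c) q' z.1 z.2) q : ℂ) * C c q z.1 z.2
            ∂(D (π c)).extMeasure (axialLaw P k) := by
    intro t ht
    have hci : ∀ c ∈ terms'.filter (fun c => π c = t),
        Integrable (fun q => Xf t q z.1 z.2 * (normW (D t) (axialLaw P k) (fun q' => W t q' z.1 z.2) q : ℂ) * C c q z.1 z.2)
          ((D t).extMeasure (axialLaw P k)) := by
      intro c hc
      obtain ⟨hc', hct⟩ := Finset.mem_filter.mp hc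
      subst hct
      exact hCi c hc' z.1 z.2
    simp_rw [hC t ht _ z.1 z.2, Finset.mul_sum]
    rw [integral_finsetSum _ hci]
    refine Finset.sum_congr rfl fun c hc => ?_
    obtain ⟨_, hct⟩ := Finset.mem_filter.mp hc
    subst hct
    rfl
  rw [Finset.sum_congr rfl e1, Finset.sum_fiberwise_of_maps_to hπ]
  -- (iv) group by hole family; (v) the (4.1)-coordinates of the exterior measures
  rw [← Finset.sum_fiberwise_of_maps_to hh]
  refine Finset.sum_congr rfl fun ω _ => Finset.sum_congr rfl fun c hc => ?_
  obtain ⟨hc', _⟩ := Finset.mem_filter.mp hc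
  exact integral_extMeasure_axial (D (π c)) (hYm c hc' z.1 z.2).aestronglyMeasurable

end Result

end

end Literature.MathematicalPhysics.QuantumFieldTheory.BalabanImbrieJaffe1984to88.BIJ88Eq596FibreIntegral
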